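import Mathlib
import HarnessLib

/-!
# Teräväinen 2024, Lemma 5.5: small derivatives in `L¹` force near-constancy

Support file (everything PROVED; no definitions, no named facts) towards the named fact
`Literature.NumberTheory.Sieve.teravainen2024_cor_2_1` (J. Teräväinen, *On the Liouville function
at polynomial arguments*, Amer. J. Math. 146 (2024) = arXiv:2010.07924, Corollary 2.1), whose
printed proof is the special case `g_j = λ` of Theorem 2.6 there (§5). Step 3 of that proof is
Proposition 5.3 (a 99% inverse theorem for averages along arithmetic progressions, §5.3), whose
proof "integrates" repeatedly by means of the following lemma, printed as

> **Lemma 5.5** (Derivative of `G` being small in `L¹` implies that `G` is almost constant). Let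
> `η > ε > 0`. Let `I ⊂ ℤ_N` be an interval of length `≥ εηN`. Suppose that a function
> `G : I → ℝ/ℤ` satisfies `𝔼_{x∈I} ‖∂_ℓ G(x)‖ ≪ η` for all `ℓ ∈ [-εηN, εηN]`. Then, given any
> partition `𝓘` of `I` into intervals of lengths `∈ [εηN/200, εηN/100]`, there exist constants
> `c_J ∈ ℝ/ℤ` such that `𝔼_{J∈𝓘} 𝔼_{x∈J} ‖G(x) - c_J‖ ≪ η^{1/2}`.

(`∂_ℓ G(x) = G(x+ℓ) - G(x)`; `‖·‖` is the distance to `0` in `ℝ/ℤ`.)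

## What is proved, and in which form

The printed proof (Markov's inequality in `ℓ`; the set `𝒳` of points lying in few exceptional
sets; a common good shift `ℓ` for two nearby points of `𝒳`; the triangle inequality) is followed
verbatim, with the implied constants made explicit and in the natural generality of the argument:
`G : ℤ → E` for any seminormed abelian group `E` (for `E = ℝ/ℤ = UnitAddCircle` one has the
printed setting, with `‖G(x) - G(y)‖ ≤ D := 1/2`), `I` any finite set of integers (an interval in
print), the shift range `[-L, L]` (`L = εηN` in print, an integer here), an `L¹` bound `κ` (`= Cη`)
and a pointwise threshold `a` (`= η^{1/2}`):

* `Teravainen2024.exists_almostConst_set` — the heart of the printed proof: if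
  `∑_{x∈I} ‖G(x+ℓ) - G(x)‖ ≤ κ·#I` for all `|ℓ| ≤ L`, there is `𝒳 ⊆ I` with
  `#(I ∖ 𝒳) ≤ 30 (κ/a) #I` such that `‖G(x) - G(y)‖ ≤ 2a` for all `x, y ∈ 𝒳` with `|x - y| ≤ L`
  (the printed argument is stated for `|x - y| ≤ εηN/100`; it gives `≤ εηN` verbatim);
* `Teravainen2024.exists_const_near_on_part` — on any `J` of diameter `≤ L` some constant `c_J`
  has `∑_{x∈J} ‖G(x) - c_J‖ ≤ 2a·#J + D·#(J ∖ 𝒳)`;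
* `Teravainen2024.lemma_5_5` — the printed conclusion for a partition of an interval
  `I = [b₀, b_r)` into consecutive intervals `J_k = [b_k, b_{k+1})` of lengths in `[L/200, L/100]`:
  constants `c_k` with `(1/r) ∑_k (1/#J_k) ∑_{x∈J_k} ‖G(x) - c_k‖ ≤ 2a + 60·D·κ/a`
  (`= (2 + 30C) η^{1/2}` for `a = η^{1/2}`, `κ = Cη`, `D = 1/2`).

## References
* J. Teräväinen, Amer. J. Math. 146 (2024), no. 4, 1115–1167, §5.3, Lemma 5.5 and its proof
  (arXiv:2010.07924, p. 13). [Teravainen2024]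
-/

noncomputable section

open Finset

namespace Literature.NumberTheory.Sieve

namespace Teravainen2024

variable {E : Type*} [SeminormedAddCommGroup E]

/-- **Teräväinen 2024, proof of Lemma 5.5 (the set `𝒳`).** Let `G : ℤ → E`, `I` a finite set of
integers, `L ≥ 1`, `a > 0`, and suppose `∑_{x∈I} ‖G(x+ℓ) - G(x)‖ ≤ κ·#I` for every integer shift
`|ℓ| ≤ L`. Then there is `𝒳 ⊆ I` with `#(I ∖ 𝒳) ≤ 30(κ/a)·#I` on which `G` is `2a`-almost
constant at scale `L`: `‖G(x) - G(y)‖ ≤ 2a` whenever `x, y ∈ 𝒳`, `|x - y| ≤ L`. (`𝒳` is the set of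
`x ∈ I` lying in at most `L/10` of the exceptional sets
`𝓔'_ℓ = {x : ‖G(x+ℓ) - G(x)‖ > a}`; two nearby points of `𝒳` share a good shift.)
[cite: Teravainen2024, Lemma 5.5 (proof)] -/
theorem exists_almostConst_set (G : ℤ → E) (I : Finset ℤ) {L : ℕ} (hL : 1 ≤ L) {a κ : ℝ}
    (ha : 0 < a) (hG : ∀ ℓ : ℤ, |ℓ| ≤ L → ∑ x ∈ I, ‖G (x + ℓ) - G x‖ ≤ κ * #I) :
    ∃ X : Finset ℤ, X ⊆ I ∧ ((#(I \ X) : ℝ) ≤ 30 * (κ / a) * #I) ∧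
      ∀ x ∈ X, ∀ y ∈ X, |x - y| ≤ L → ‖G x - G y‖ ≤ 2 * a := by
  classical
  set S : Finset ℤ := Icc (-(L : ℤ)) L with hS_def
  set bad : ℤ → Finset ℤ := fun x => S.filter fun ℓ => a < ‖G (x + ℓ) - G x‖ with hbad
  set X : Finset ℤ := I.filter fun x => 10 * #(bad x) ≤ L with hX
  have hmemS : ∀ ℓ : ℤ, ℓ ∈ S ↔ |ℓ| ≤ L := fun ℓ => by
    rw [hS_def, Finset.mem_Icc, abs_le]
  have hLR : (1 : ℝ) ≤ L := by exact_mod_cast hL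
  refine ⟨X, Finset.filter_subset _ _, ?_, ?_⟩
  · /- the size of the exceptional set `I ∖ 𝒳` -/
    -- Markov's inequality for each shift
    have hMarkov : ∀ ℓ ∈ S,
        a * #(I.filter fun x => a < ‖G (x + ℓ) - G x‖) ≤ κ * #I := by
      intro ℓ hℓ
      calc a * #(I.filter fun x => a < ‖G (x + ℓ) - G x‖)
          = ∑ x ∈ I.filter (fun x => a < ‖G (x + ℓ) - G x‖), a := by
            rw [Finset.sum_const, nsmul_eq_mul, mul_comm]
        _ ≤ ∑ x ∈ I.filter (fun x => a < ‖G (x + ℓ) - G x‖), ‖G (x + ℓ) - G x‖ :=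
            Finset.sum_le_sum fun x hx => (Finset.mem_filter.mp hx).2.le
        _ ≤ ∑ x ∈ I, ‖G (x + ℓ) - G x‖ :=
            Finset.sum_le_sum_of_subset_of_nonneg (Finset.filter_subset _ _)
              fun _ _ _ => norm_nonneg _
        _ ≤ κ * #I := hG ℓ ((hmemS ℓ).mp hℓ)
    -- double counting of the bad pairs `(x, ℓ)`
    have hdc : ∑ x ∈ I, (#(bad x) : ℝ) =
        ∑ ℓ ∈ S, (#(I.filter fun x => a < ‖G (x + ℓ) - G x‖) : ℝ) := by
      simp only [hbad, Finset.card_filter]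
      push_cast
      exact Finset.sum_comm
    -- outside `𝒳` a point has more than `L/10` bad shifts
    have h3 : (L : ℝ) * #(I \ X) ≤ 10 * ∑ x ∈ I \ X, (#(bad x) : ℝ) := by
      rw [Finset.mul_sum]
      calc (L : ℝ) * #(I \ X) = ∑ x ∈ I \ X, (L : ℝ) := by
            rw [Finset.sum_const, nsmul_eq_mul, mul_comm]
        _ ≤ ∑ x ∈ I \ X, 10 * (#(bad x) : ℝ) := Finset.sum_le_sum fun x hx => by
            rw [Finset.mem_sdiff, hX, Finset.mem_filter, not_and] at hx
            have h := hx.2 hx.1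
            rw [not_le] at h
            exact_mod_cast h.le
    have h4 : ∑ x ∈ I \ X, (#(bad x) : ℝ) ≤ ∑ x ∈ I, (#(bad x) : ℝ) :=
      Finset.sum_le_sum_of_subset_of_nonneg Finset.sdiff_subset fun _ _ _ => by positivity
    have h5 : ∑ ℓ ∈ S, (#(I.filter fun x => a < ‖G (x + ℓ) - G x‖) : ℝ) ≤
        #S * (κ * #I / a) := by
      calc ∑ ℓ ∈ S, (#(I.filter fun x => a < ‖G (x + ℓ) - G x‖) : ℝ)
          ≤ ∑ ℓ ∈ S, κ * #I / a := Finset.sum_le_sum fun ℓ hℓ => by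
            rw [le_div_iff₀ ha, mul_comm]
            exact hMarkov ℓ hℓ
        _ = #S * (κ * #I / a) := by rw [Finset.sum_const, nsmul_eq_mul]
    have hScard : (#S : ℝ) = 2 * L + 1 := by
      have h : #S = 2 * L + 1 := by
        rw [hS_def, Int.card_Icc]
        omega
      rw [h]
      push_cast
      ring
    -- `κ·#I ≥ 0` (the hypothesis at `ℓ = 0`)
    have hκI : 0 ≤ κ * #I :=
      le_trans (Finset.sum_nonneg fun _ _ => norm_nonneg _) (hG 0 (by simp))
    have h6 : (L : ℝ) * #(I \ X) ≤ 10 * ((2 * L + 1) * (κ * #I / a)) := by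
      rw [← hScard]
      linarith
    have h7 : 10 * ((2 * L + 1) * (κ * #I / a)) ≤ (L : ℝ) * (30 * (κ / a) * #I) := by
      have h8 : 0 ≤ κ * #I / a := div_nonneg hκI ha.le
      have h9 : 10 * ((2 * (L : ℝ) + 1) * (κ * #I / a)) = (20 * L + 10) * (κ * #I / a) := by
        ring
      have h10 : (L : ℝ) * (30 * (κ / a) * #I) = (30 * L) * (κ * #I / a) := by ring
      rw [h9, h10]
      exact mul_le_mul_of_nonneg_right (by linarith) h8
    exact le_of_mul_le_mul_left (h6.trans h7) (by linarith)
  · /- almost constancy on `𝒳` -/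
    intro x hx y hy hxy
    wlog hle : x ≤ y generalizing x y
    · rw [norm_sub_rev]
      rw [abs_sub_comm] at hxy
      exact this y hy x hx hxy (not_le.mp hle).le
    rw [hX, Finset.mem_filter] at hx hy
    obtain ⟨-, hxb⟩ := hx
    obtain ⟨-, hyb⟩ := hy
    obtain ⟨d, hd⟩ : ∃ d : ℤ, d = y - x := ⟨_, rfl⟩
    have hd0 : 0 ≤ d := by omega
    have hdL : d ≤ L := by rw [abs_le] at hxy; omega
    -- candidate shifts and the two families of bad ones
    set cand : Finset ℤ := Icc (-(L : ℤ) + d) L with hcand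
    have hcard_cand : #cand = 2 * L + 1 - d.toNat := by
      rw [hcand, Int.card_Icc]
      omega
    set B2 : Finset ℤ := (bad y).image fun ℓ => ℓ + d with hB2
    have hB2card : #B2 ≤ #(bad y) := Finset.card_image_le
    have hlt : #(bad x ∪ B2) < #cand := by
      have h1 := Finset.card_union_le (bad x) B2
      have h2 : d.toNat ≤ L := by omega
      omega
    obtain ⟨ℓ, hℓc, hℓgood⟩ := Finset.exists_mem_notMem_of_card_lt_card hlt
    rw [Finset.mem_union, not_or] at hℓgood
    obtain ⟨hℓ1, hℓ2⟩ := hℓgood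
    rw [hcand, Finset.mem_Icc] at hℓc
    -- `ℓ` is a good shift at `x`
    have hℓS : ℓ ∈ S := by
      rw [hmemS, abs_le]
      omega
    have hgx : ‖G (x + ℓ) - G x‖ ≤ a := by
      by_contra h
      rw [not_le] at h
      exact hℓ1 (Finset.mem_filter.mpr ⟨hℓS, h⟩)
    -- `ℓ - d` is a good shift at `y`
    have hℓ'S : ℓ - d ∈ S := by
      rw [hmemS, abs_le]
      omega
    have hgy : ‖G (y + (ℓ - d)) - G y‖ ≤ a := by
      by_contra h
      rw [not_le] at h
      apply hℓ2
      rw [hB2, Finset.mem_image]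
      exact ⟨ℓ - d, Finset.mem_filter.mpr ⟨hℓ'S, h⟩, by ring⟩
    have hyx : y + (ℓ - d) = x + ℓ := by omega
    rw [hyx] at hgy
    calc ‖G x - G y‖ ≤ ‖G x - G (x + ℓ)‖ + ‖G (x + ℓ) - G y‖ := norm_sub_le_norm_sub_add_norm_sub _ _ _
      _ = ‖G (x + ℓ) - G x‖ + ‖G (x + ℓ) - G y‖ := by rw [norm_sub_rev]
      _ ≤ a + a := add_le_add hgx hgy
      _ = 2 * a := by ring

/-- **One part of the partition** (Teräväinen 2024, last step of the proof of Lemma 5.5): if `G`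
is `2a`-almost constant on `𝒳` at scale `L` and all values of `G` are within `D` of each other,
then on every finite `J ⊆ ℤ` of diameter `≤ L` some constant `c_J` satisfies
`∑_{x∈J} ‖G(x) - c_J‖ ≤ 2a·#J + D·#(J ∖ 𝒳)`. [cite: Teravainen2024, Lemma 5.5 (proof)] -/
theorem exists_const_near_on_part (G : ℤ → E) {X J : Finset ℤ} {L : ℕ} {a D : ℝ} (ha : 0 ≤ a)
    (hD : ∀ x y, ‖G x - G y‖ ≤ D)
    (hX : ∀ x ∈ X, ∀ y ∈ X, |x - y| ≤ L → ‖G x - G y‖ ≤ 2 * a)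
    (hJ : ∀ x ∈ J, ∀ y ∈ J, |x - y| ≤ L) :
    ∃ c : E, ∑ x ∈ J, ‖G x - c‖ ≤ 2 * a * #J + D * #(J \ X) := by
  classical
  have hD0 : 0 ≤ D := le_trans (norm_nonneg _) (hD 0 0)
  by_cases hne : (J ∩ X).Nonempty
  · obtain ⟨x₀, hx₀⟩ := hne
    rw [Finset.mem_inter] at hx₀
    refine ⟨G x₀, ?_⟩
    rw [← Finset.sum_filter_add_sum_filter_not J (fun x => x ∈ X)]
    have h1 : ∑ x ∈ J.filter (fun x => x ∈ X), ‖G x - G x₀‖ ≤ 2 * a * #J := by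
      calc ∑ x ∈ J.filter (fun x => x ∈ X), ‖G x - G x₀‖
          ≤ ∑ x ∈ J.filter (fun x => x ∈ X), 2 * a := Finset.sum_le_sum fun x hx => by
            rw [Finset.mem_filter] at hx
            exact hX x hx.2 x₀ hx₀.2 (hJ x hx.1 x₀ hx₀.1)
        _ = 2 * a * #(J.filter fun x => x ∈ X) := by
            rw [Finset.sum_const, nsmul_eq_mul, mul_comm]
        _ ≤ 2 * a * #J := by
            gcongr
            exact Finset.filter_subset _ _
    have h2 : ∑ x ∈ J.filter (fun x => ¬x ∈ X), ‖G x - G x₀‖ ≤ D * #(J \ X) := by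
      have hfs : J.filter (fun x => ¬x ∈ X) = J \ X := by
        ext x
        simp [Finset.mem_sdiff]
      rw [hfs]
      calc ∑ x ∈ J \ X, ‖G x - G x₀‖ ≤ ∑ x ∈ J \ X, D := Finset.sum_le_sum fun x _ => hD x x₀
        _ = D * #(J \ X) := by rw [Finset.sum_const, nsmul_eq_mul, mul_comm]
    linarith
  · refine ⟨G 0, ?_⟩
    have hJX : J \ X = J := by
      rw [Finset.sdiff_eq_self_iff_disjoint, Finset.disjoint_iff_inter_eq_empty]
      exact Finset.not_nonempty_iff_eq_empty.mp hne
    rw [hJX]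
    calc ∑ x ∈ J, ‖G x - G 0‖ ≤ ∑ x ∈ J, D := Finset.sum_le_sum fun x _ => hD x 0
      _ = D * #J := by rw [Finset.sum_const, nsmul_eq_mul, mul_comm]
      _ ≤ 2 * a * #J + D * #J := by nlinarith [Nat.cast_nonneg (α := ℝ) #J]

/-- Summing over consecutive blocks: for a monotone sequence of cut points `b₀ ≤ b₁ ≤ ⋯ ≤ b_r`,
`∑_{k<r} ∑_{x∈[b_k,b_{k+1})} f(x) = ∑_{x∈[b₀,b_r)} f(x)`. [folklore] -/
theorem sum_blocks_eq_sum_Ico (b : ℕ → ℤ) (hb : Monotone b) (f : ℤ → ℝ) (r : ℕ) :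
    ∑ k ∈ range r, ∑ x ∈ Ico (b k) (b (k + 1)), f x = ∑ x ∈ Ico (b 0) (b r), f x := by
  induction r with
  | zero => simp
  | succ r ih =>
    rw [Finset.sum_range_succ, ih, ← Finset.sum_union (Finset.Ico_disjoint_Ico_consecutive _ _ _),
      Finset.Ico_union_Ico_eq_Ico (hb (Nat.zero_le r)) (hb (Nat.le_succ r))]

/-- **Teräväinen 2024, Lemma 5.5** (derivative of `G` small in `L¹` ⟹ `G` almost constant), with
explicit constants. Let `G : ℤ → E` take values within `D` of each other (`D = 1/2` for
`E = ℝ/ℤ`), let `I = [b₀, b_r)` be an interval of integers partitioned into consecutive intervals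
`J_k = [b_k, b_{k+1})` (`k < r`, `r ≥ 1`) of lengths in `[L/200, L/100]`, `L ≥ 1`, and suppose
`∑_{x∈I} ‖G(x+ℓ) - G(x)‖ ≤ κ·#I` for all `|ℓ| ≤ L`. Then for every `a > 0` there are constants
`c_k` with `(1/r) ∑_{k<r} (1/#J_k) ∑_{x∈J_k} ‖G(x) - c_k‖ ≤ 2a + 60·D·κ/a`. In print:
`L = εηN`, `κ = Cη` (the implied constant of the hypothesis `𝔼‖∂_ℓ G‖ ≪ η`), `a = η^{1/2}`,
`D = 1/2`, giving `𝔼_{J} 𝔼_{x∈J} ‖G(x) - c_J‖ ≤ (2 + 30C) η^{1/2}`; the printed lower bound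
`#I ≥ εηN` on the length of `I` is implied by `r ≥ 1` up to the factor `200` and is not needed.
[cite: Teravainen2024, Lemma 5.5] -/
theorem lemma_5_5 (G : ℤ → E) {D : ℝ} (hD : ∀ x y, ‖G x - G y‖ ≤ D) {L : ℕ} (hL : 1 ≤ L)
    (b : ℕ → ℤ) {r : ℕ} (hr : 1 ≤ r)
    (hlen : ∀ k < r, (L : ℝ) / 200 ≤ ((b (k + 1) - b k : ℤ) : ℝ) ∧
      ((b (k + 1) - b k : ℤ) : ℝ) ≤ (L : ℝ) / 100)
    (hmono : Monotone b) {κ : ℝ}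
    (hG : ∀ ℓ : ℤ, |ℓ| ≤ L →
      ∑ x ∈ Ico (b 0) (b r), ‖G (x + ℓ) - G x‖ ≤ κ * #(Ico (b 0) (b r)))
    {a : ℝ} (ha : 0 < a) :
    ∃ c : ℕ → E,
      (1 / r : ℝ) * ∑ k ∈ range r, (1 / #(Ico (b k) (b (k + 1))) : ℝ) *
          ∑ x ∈ Ico (b k) (b (k + 1)), ‖G x - c k‖ ≤ 2 * a + 60 * D * κ / a := by
  classical
  set I : Finset ℤ := Ico (b 0) (b r) with hI
  obtain ⟨X, -, hXcard, hXconst⟩ := exists_almostConst_set G I hL ha hG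
  have hD0 : 0 ≤ D := le_trans (norm_nonneg _) (hD 0 0)
  have hLR : (1 : ℝ) ≤ L := by exact_mod_cast hL
  have hrR : (1 : ℝ) ≤ r := by exact_mod_cast hr
  -- sizes of the parts
  have hcardJ : ∀ k, (#(Ico (b k) (b (k + 1))) : ℝ) = ((b (k + 1) - b k : ℤ) : ℝ) := fun k => by
    rw [Int.card_Ico]
    have h : 0 ≤ b (k + 1) - b k := sub_nonneg.mpr (hmono (Nat.le_succ k))
    rw [← Int.cast_natCast, Int.toNat_of_nonneg h]
  -- the diameter of a part is `≤ L/100 ≤ L`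
  have hdiam : ∀ k < r, ∀ x ∈ Ico (b k) (b (k + 1)), ∀ y ∈ Ico (b k) (b (k + 1)),
      |x - y| ≤ (L : ℤ) := by
    intro k hk x hx y hy
    rw [Finset.mem_Ico] at hx hy
    have h1 := (hlen k hk).2
    have h2 : ((b (k + 1) - b k : ℤ) : ℝ) ≤ L := by
      have : (L : ℝ) / 100 ≤ L := by
        rw [div_le_iff₀ (by norm_num : (0 : ℝ) < 100)]
        nlinarith
      linarith
    have h3 : b (k + 1) - b k ≤ L := by exact_mod_cast h2
    rw [abs_le]
    omega
  -- constants part by part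
  have hpart : ∀ k < r, ∃ c : E, ∑ x ∈ Ico (b k) (b (k + 1)), ‖G x - c‖ ≤
      2 * a * #(Ico (b k) (b (k + 1))) + D * #(Ico (b k) (b (k + 1)) \ X) := fun k hk =>
    exists_const_near_on_part G ha.le hD hXconst (hdiam k hk)
  choose! c hc using hpart
  refine ⟨c, ?_⟩
  -- normalised bound on each part
  have hk_bound : ∀ k ∈ range r,
      (1 / #(Ico (b k) (b (k + 1))) : ℝ) * ∑ x ∈ Ico (b k) (b (k + 1)), ‖G x - c k‖ ≤
        2 * a + D * (200 / L) * #(Ico (b k) (b (k + 1)) \ X) := by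
    intro k hk
    rw [Finset.mem_range] at hk
    have hJpos : (0 : ℝ) < #(Ico (b k) (b (k + 1))) := by
      rw [hcardJ]
      have := (hlen k hk).1
      have : (0 : ℝ) < L / 200 := by positivity
      linarith
    have hJlow : (L : ℝ) / 200 ≤ #(Ico (b k) (b (k + 1))) := by
      rw [hcardJ]
      exact (hlen k hk).1
    rw [one_div, inv_mul_le_iff₀ hJpos]
    refine (hc k hk).trans ?_
    have hsd : (0 : ℝ) ≤ #(Ico (b k) (b (k + 1)) \ X) := Nat.cast_nonneg _
    have h1 : D * #(Ico (b k) (b (k + 1)) \ X) ≤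
        #(Ico (b k) (b (k + 1))) * (D * (200 / L) * #(Ico (b k) (b (k + 1)) \ X)) := by
      have h2 : (1 : ℝ) ≤ #(Ico (b k) (b (k + 1))) * (200 / L) := by
        rw [mul_div_assoc', le_div_iff₀ (by positivity), one_mul]
        linarith
      calc D * #(Ico (b k) (b (k + 1)) \ X)
          = 1 * (D * #(Ico (b k) (b (k + 1)) \ X)) := by ring
        _ ≤ (#(Ico (b k) (b (k + 1))) * (200 / L)) * (D * #(Ico (b k) (b (k + 1)) \ X)) :=
            mul_le_mul_of_nonneg_right h2 (by positivity)
        _ = #(Ico (b k) (b (k + 1))) * (D * (200 / L) * #(Ico (b k) (b (k + 1)) \ X)) := by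
            ring
    nlinarith
  -- sum over the parts: `∑_k #(J_k ∖ 𝒳) = #(I ∖ 𝒳)`
  have hsumX : ∑ k ∈ range r, (#(Ico (b k) (b (k + 1)) \ X) : ℝ) = #(I \ X) := by
    have h : ∀ J : Finset ℤ, (#(J \ X) : ℝ) = ∑ x ∈ J, if x ∈ X then (0 : ℝ) else 1 := by
      intro J
      rw [Finset.sum_ite, Finset.sum_const_zero, zero_add, Finset.sum_const, nsmul_eq_mul,
        mul_one]
      congr 2
      ext x
      simp [Finset.mem_sdiff]
    simp only [h]
    rw [hI]
    exact sum_blocks_eq_sum_Ico b hmono _ r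
  -- total length: `#I = ∑_k #J_k ≤ r L / 100`
  have hsumJ : ∑ k ∈ range r, (#(Ico (b k) (b (k + 1))) : ℝ) = #I := by
    have h : ∀ J : Finset ℤ, (#J : ℝ) = ∑ x ∈ J, (1 : ℝ) := fun J => by simp
    simp only [h]
    rw [hI]
    exact sum_blocks_eq_sum_Ico b hmono _ r
  have hIle : (#I : ℝ) ≤ r * (L / 100) := by
    rw [← hsumJ]
    calc ∑ k ∈ range r, (#(Ico (b k) (b (k + 1))) : ℝ) ≤ ∑ k ∈ range r, (L : ℝ) / 100 :=
          Finset.sum_le_sum fun k hk => by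
            rw [hcardJ]
            exact (hlen k (Finset.mem_range.mp hk)).2
      _ = r * (L / 100) := by rw [Finset.sum_const, Finset.card_range, nsmul_eq_mul]
  -- assemble
  have htotal : ∑ k ∈ range r, (1 / #(Ico (b k) (b (k + 1))) : ℝ) *
      ∑ x ∈ Ico (b k) (b (k + 1)), ‖G x - c k‖ ≤
        r * (2 * a) + D * (200 / L) * #(I \ X) := by
    calc ∑ k ∈ range r, (1 / #(Ico (b k) (b (k + 1))) : ℝ) *
          ∑ x ∈ Ico (b k) (b (k + 1)), ‖G x - c k‖
        ≤ ∑ k ∈ range r, (2 * a + D * (200 / L) * #(Ico (b k) (b (k + 1)) \ X)) :=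
          Finset.sum_le_sum hk_bound
      _ = r * (2 * a) + D * (200 / L) * #(I \ X) := by
          rw [Finset.sum_add_distrib, Finset.sum_const, Finset.card_range, nsmul_eq_mul,
            ← Finset.mul_sum, hsumX]
  have hκI : 0 ≤ κ * #I :=
    le_trans (Finset.sum_nonneg fun _ _ => norm_nonneg _) (hG 0 (by simp))
  -- `I` is non-empty (it has `r ≥ 1` parts of length `≥ L/200`), so `κ ≥ 0`
  have hIpos : (0 : ℝ) < #I := by
    rw [← hsumJ]
    have hrL : (0 : ℝ) < r * (L / 200) := mul_pos (by linarith) (div_pos (by linarith) (by norm_num))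
    calc (0 : ℝ) < r * (L / 200) := hrL
      _ = ∑ k ∈ range r, (L : ℝ) / 200 := by
          rw [Finset.sum_const, Finset.card_range, nsmul_eq_mul]
      _ ≤ ∑ k ∈ range r, (#(Ico (b k) (b (k + 1))) : ℝ) := Finset.sum_le_sum fun k hk => by
          rw [hcardJ]
          exact (hlen k (Finset.mem_range.mp hk)).1
  have hκ : 0 ≤ κ := by
    by_contra h
    rw [not_le] at h
    nlinarith
  have hXI : D * (200 / L) * #(I \ X) ≤ r * (60 * D * κ / a) := by
    calc D * (200 / L) * #(I \ X) ≤ D * (200 / L) * (30 * (κ / a) * #I) :=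
          mul_le_mul_of_nonneg_left hXcard (by positivity)
      _ = (6000 * D / (L * a)) * (κ * #I) := by
          field_simp
          ring
      _ ≤ (6000 * D / (L * a)) * (κ * (r * (L / 100))) :=
          mul_le_mul_of_nonneg_left (mul_le_mul_of_nonneg_left hIle hκ) (by positivity)
      _ = r * (60 * D * κ / a) := by
          field_simp
          ring
  have hrpos : (0 : ℝ) < r := by linarith
  rw [one_div, inv_mul_le_iff₀ hrpos]
  calc ∑ k ∈ range r, (1 / #(Ico (b k) (b (k + 1))) : ℝ) *
        ∑ x ∈ Ico (b k) (b (k + 1)), ‖G x - c k‖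
      ≤ r * (2 * a) + D * (200 / L) * #(I \ X) := htotal
    _ ≤ r * (2 * a) + r * (60 * D * κ / a) := by linarith
    _ = r * (2 * a + 60 * D * κ / a) := by ring

end Teravainen2024

end Literature.NumberTheory.Sieve
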